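import Summits.Ventures.HodgeRepro.FaceReduce

/-!
# Characters and discrete Fourier analysis on `ℤ/N` for CM types (the toolkit of `CyclicPrimePowerNoSingleClass`)

Blind re-derivation cell `pub-hodge-repro`, seat `p1` (gen 8).  The cyclic Galois CM fields are `(ℤ/N, N/2)` in the
typer's finite model; this file is the analytic toolkit for `CyclicPrimePowerNoSingleClass.lean`, on Mathlib's
standard character `ψ = ZMod.stdAddChar : AddChar (ZMod N) ℂ` and discrete Fourier transform `ZMod.dft`:

* `four_roots` — **a vanishing sum of four roots of unity contains an antipodal pair** (`ψ a + ψ b + ψ c + ψ d = 0`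
  forces `ψ(b − a) = −1` or `ψ(c − a) = −1` or `ψ(d − a) = −1`); algebraic proof: from `1 + u + v + w = 0` and its
  complex conjugate `1 + u⁻¹ + v⁻¹ + w⁻¹ = 0` one gets `(u − v w⁻¹)(u − w v⁻¹) = 0`, then `(1 + w)(1 + u) = 0` or
  `(1 + v)(1 + u) = 0` (`four_roots_aux`);
* `stdAddChar_eq_neg_one_iff` — `ψ x = −1` exactly at the involution `x = N/2`;
* `eq_neg_one_of_pow_eq_neg_one` — a `P`-th root of unity (`P` even) whose `k`-th power is `−1`, `k` coprime to `P`,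
  is `−1`;
* `dft_shift`, `dft_const`, `periodic_of_dft` — translation, constants, and **periodicity from the Fourier support**
  (if every `k` with `𝓕f(k) ≠ 0` has `ψ(P k) = 1` then `f` is `P`-periodic), by Fourier inversion (`ZMod.dft_dft`);
* `ind Φ` — the indicator of a CM type `Φ ⊂ ℤ/N` (the typer's `Finset (Multiplicative (ZMod N))`), with the CM condition
  `1_Φ(x + N/2) = 1 − 1_Φ(x)` (`ind_add_half`), the Fourier form of `SumTwo` for four Galois twists
  `(∑ᵢ ψ(−gᵢ k)) · 𝓕(1_Φ)(k) = 0` for `k ≠ 0` (`char_sum_mul_dft`), the vanishing of `𝓕(1_Φ)` at even `k`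
  (`dft_ind_eq_zero_of_even`), and the translation of a shift identity `1_Φ(x + (gᵢ − gⱼ)) = 1_Φ(x + N/2)` into a
  complex-conjugate pair of corners `Φ gⱼ = c • Φ gᵢ` (`conj_pair_of_shift`).
`N/2` is a complex conjugation in the typer's sense (`isComplexConj_ofAdd_half`).
-/

set_option autoImplicit false

open Finset AddChar ZMod
open scoped Pointwise

namespace HodgeRepro.CyclicQuad

variable {N : ℕ} [NeZero N]

/-! ### Characters of `ℤ/N`: norm one, the value `-1`, vanishing sums of four values -/

/-- Values of the standard character have norm `1`. -/
theorem norm_stdAddChar (x : ZMod N) : ‖stdAddChar x‖ = 1 := by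
  rw [ZMod.stdAddChar_apply]; exact Circle.norm_coe _

/-- Values of the standard character are non-zero. -/
theorem stdAddChar_ne_zero (x : ZMod N) : stdAddChar x ≠ 0 := by
  intro h
  have h1 := norm_stdAddChar x
  rw [h, norm_zero] at h1
  exact zero_ne_one h1

/-- The complex conjugate of a character value is its inverse. -/
theorem conj_stdAddChar (x : ZMod N) : (starRingEnd ℂ) (stdAddChar x) = (stdAddChar x)⁻¹ :=
  (Complex.inv_eq_conj (norm_stdAddChar x)).symm

/-- Algebraic core of the four-roots lemma: if `1 + u + v + w = 0` and `1 + u⁻¹ + v⁻¹ + w⁻¹ = 0` (non-zero `u v w`),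
then one of `u, v, w` is `-1`. -/
theorem four_roots_aux {u v w : ℂ} (hu0 : u ≠ 0) (hv0 : v ≠ 0) (hw0 : w ≠ 0)
    (h1 : 1 + u + v + w = 0) (h2 : 1 + u⁻¹ + v⁻¹ + w⁻¹ = 0) : u = -1 ∨ v = -1 ∨ w = -1 := by
  have hu' : u * u⁻¹ = 1 := mul_inv_cancel₀ hu0
  have hv' : v * v⁻¹ = 1 := mul_inv_cancel₀ hv0
  have hw' : w * w⁻¹ = 1 := mul_inv_cancel₀ hw0
  have h3 : (1 + u) * (1 + u⁻¹) = (v + w) * (v⁻¹ + w⁻¹) := by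
    have e1 : 1 + u = -(v + w) := by linear_combination h1
    have e2 : 1 + u⁻¹ = -(v⁻¹ + w⁻¹) := by linear_combination h2
    rw [e1, e2]; ring
  have h4 : u + u⁻¹ = v * w⁻¹ + w * v⁻¹ := by linear_combination h3 - hu' + hv' + hw'
  have hvw : (v * w⁻¹) * (w * v⁻¹) = 1 := by
    calc (v * w⁻¹) * (w * v⁻¹) = (v * v⁻¹) * (w * w⁻¹) := by ring
      _ = 1 := by rw [hv', hw', one_mul]
  have h5 : (u - v * w⁻¹) * (u - w * v⁻¹) = 0 := by linear_combination u * h4 + hvw - hu'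
  rcases mul_eq_zero.mp h5 with h6 | h6
  · have hu : u = v * w⁻¹ := sub_eq_zero.mp h6
    have h7 : (1 + w) * (1 + u) = 0 := by linear_combination h1 + w * hu + v * hw'
    rcases mul_eq_zero.mp h7 with h8 | h8
    · exact Or.inr (Or.inr (eq_neg_of_add_eq_zero_right h8))
    · exact Or.inl (eq_neg_of_add_eq_zero_right h8)
  · have hu : u = w * v⁻¹ := sub_eq_zero.mp h6
    have h7 : (1 + v) * (1 + u) = 0 := by linear_combination h1 + v * hu + w * hv'
    rcases mul_eq_zero.mp h7 with h8 | h8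
    · exact Or.inr (Or.inl (eq_neg_of_add_eq_zero_right h8))
    · exact Or.inl (eq_neg_of_add_eq_zero_right h8)

/-- **Four roots of unity summing to zero contain an antipodal pair**: if `ψ a + ψ b + ψ c + ψ d = 0` then one of
`b − a`, `c − a`, `d − a` is sent to `-1` by `ψ` (no minimal vanishing sum of length four exists). -/
theorem four_roots {a b c d : ZMod N}
    (h : stdAddChar a + stdAddChar b + stdAddChar c + stdAddChar d = 0) :
    stdAddChar (b - a) = -1 ∨ stdAddChar (c - a) = -1 ∨ stdAddChar (d - a) = -1 := by
  have hb : stdAddChar b = stdAddChar a * stdAddChar (b - a) := by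
    rw [← map_add_eq_mul]; congr 1; abel
  have hc : stdAddChar c = stdAddChar a * stdAddChar (c - a) := by
    rw [← map_add_eq_mul]; congr 1; abel
  have hd : stdAddChar d = stdAddChar a * stdAddChar (d - a) := by
    rw [← map_add_eq_mul]; congr 1; abel
  have h1 : 1 + stdAddChar (b - a) + stdAddChar (c - a) + stdAddChar (d - a) = 0 := by
    have h' : stdAddChar a * (1 + stdAddChar (b - a) + stdAddChar (c - a) + stdAddChar (d - a)) =
        stdAddChar a + stdAddChar b + stdAddChar c + stdAddChar d := by
      rw [hb, hc, hd]; ring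
    rw [h] at h'
    exact (mul_eq_zero.mp h').resolve_left (stdAddChar_ne_zero a)
  have h2 : 1 + (stdAddChar (b - a))⁻¹ + (stdAddChar (c - a))⁻¹ + (stdAddChar (d - a))⁻¹ = 0 := by
    have h' := congrArg (starRingEnd ℂ) h1
    rwa [map_add, map_add, map_add, map_one, map_zero, conj_stdAddChar, conj_stdAddChar,
      conj_stdAddChar] at h'
  exact four_roots_aux (stdAddChar_ne_zero _) (stdAddChar_ne_zero _) (stdAddChar_ne_zero _) h1 h2

/-- `N/2 ≠ 0` in `ℤ/N` when `N = 2m`. -/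
theorem natCast_half_ne_zero {m : ℕ} (hN : N = 2 * m) : (m : ZMod N) ≠ 0 := by
  have hN0 : N ≠ 0 := NeZero.ne N
  rw [Ne, ZMod.natCast_eq_zero_iff]
  intro hdvd
  have hm : 0 < m := by omega
  have := Nat.le_of_dvd hm hdvd
  omega

/-- The standard character takes the value `-1` at the involution `N/2`. -/
theorem stdAddChar_half {m : ℕ} (hN : N = 2 * m) : stdAddChar (m : ZMod N) = -1 := by
  have h2 : stdAddChar (m : ZMod N) ^ 2 = 1 := by
    rw [← map_nsmul_eq_pow, nsmul_eq_mul, ← Nat.cast_mul, ← hN, ZMod.natCast_self, map_zero_eq_one]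
  rcases sq_eq_one_iff.mp h2 with h | h
  · exact absurd (injective_stdAddChar (h.trans (map_zero_eq_one _).symm)) (natCast_half_ne_zero hN)
  · exact h

/-- The standard character takes the value `-1` exactly at `N/2`. -/
theorem stdAddChar_eq_neg_one_iff {m : ℕ} (hN : N = 2 * m) (x : ZMod N) :
    stdAddChar x = -1 ↔ x = (m : ZMod N) :=
  ⟨fun h => injective_stdAddChar (h.trans (stdAddChar_half hN).symm),
    fun h => h ▸ stdAddChar_half hN⟩

/-- A `P`-th root of unity (`P` even) whose `k`-th power is `-1`, with `k` coprime to `P`, is `-1`. -/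
theorem eq_neg_one_of_pow_eq_neg_one {z : ℂ} {P k : ℕ} (hP : z ^ P = 1) (h2 : 2 ∣ P)
    (hk : Nat.Coprime k P) (h : z ^ k = -1) : z = -1 := by
  obtain ⟨P', rfl⟩ := h2
  have h2k : z ^ (2 * k) = 1 := by rw [mul_comm, pow_mul, h]; norm_num
  have hcop : Nat.Coprime k P' := Nat.Coprime.coprime_dvd_right (Dvd.intro_left 2 rfl) hk
  have hg : Nat.gcd (2 * k) (2 * P') = 2 := by
    rw [Nat.gcd_mul_left, hcop.gcd_eq_one, mul_one]
  have hz2 : z ^ 2 = 1 := by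
    have := pow_gcd_eq_one.mpr ⟨h2k, hP⟩
    rwa [hg] at this
  rcases sq_eq_one_iff.mp hz2 with h1 | h1
  · rw [h1, one_pow] at h; norm_num at h
  · exact h1

/-! ### Discrete Fourier analysis on `ℤ/N` (Mathlib's `ZMod.dft`) -/

/-- Orthogonality: a non-trivial character sums to zero. -/
theorem sum_stdAddChar_mul (k : ZMod N) (hk : k ≠ 0) : ∑ j : ZMod N, stdAddChar (k * j) = 0 :=
  sum_eq_zero_of_ne_one (isPrimitive_stdAddChar N hk)

/-- The Fourier transform of a constant vanishes away from `0`. -/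
theorem dft_const (z : ℂ) (k : ZMod N) (hk : k ≠ 0) : ZMod.dft (fun _ : ZMod N => z) k = 0 := by
  simp only [ZMod.dft_apply, smul_eq_mul]
  rw [← Finset.sum_mul]
  have e : ∀ j : ZMod N, -(j * k) = (-k) * j := fun j => by ring
  simp only [e]
  rw [sum_stdAddChar_mul (-k) (neg_ne_zero.mpr hk), zero_mul]

/-- Translation becomes multiplication by a character value under `𝓕`. -/
theorem dft_shift (f : ZMod N → ℂ) (g k : ZMod N) :
    ZMod.dft (fun x => f (x - g)) k = stdAddChar (-(g * k)) * ZMod.dft f k := by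
  simp only [ZMod.dft_apply, smul_eq_mul, Finset.mul_sum]
  refine Fintype.sum_equiv (Equiv.subRight g) _ _ (fun j => ?_)
  simp only [Equiv.subRight_apply]
  rw [show -(j * k) = -(g * k) + -((j - g) * k) by ring, map_add_eq_mul, mul_assoc]

/-- Fourier inversion, unfolded. -/
theorem apply_eq_inv_sum (f : ZMod N → ℂ) (y : ZMod N) :
    f y = (N : ℂ)⁻¹ * ∑ k, stdAddChar (k * y) * ZMod.dft f k := by
  have h := congrFun (ZMod.dft.symm_apply_apply f) y
  rw [ZMod.invDFT_apply] at h
  simpa only [smul_eq_mul] using h.symm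

/-- **Periodicity from the Fourier support**: if every `k` in the support of `𝓕 f` satisfies `ψ(P k) = 1`, then
`f` is `P`-periodic. -/
theorem periodic_of_dft (f : ZMod N → ℂ) (P : ZMod N)
    (h : ∀ k, ZMod.dft f k ≠ 0 → stdAddChar (P * k) = 1) (x : ZMod N) : f (x + P) = f x := by
  rw [apply_eq_inv_sum f (x + P), apply_eq_inv_sum f x]
  congr 1
  refine Finset.sum_congr rfl (fun k _ => ?_)
  by_cases hk : ZMod.dft f k = 0
  · rw [hk, mul_zero, mul_zero]
  · rw [mul_add, map_add_eq_mul, mul_comm k P, h k hk, mul_one]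

omit [NeZero N] in
/-- A `P`-periodic function is `l • P`-periodic. -/
theorem periodic_nsmul {f : ZMod N → ℂ} {P : ZMod N} (h : ∀ x, f (x + P) = f x) (l : ℕ) (x : ZMod N) :
    f (x + l • P) = f x := by
  induction l with
  | zero => simp
  | succ n ih => rw [succ_nsmul, ← add_assoc, h, ih]

/-! ### The indicator of a CM type of `ℤ/N` and its Galois twists -/

/-- The indicator function of a subset `Φ` of `ℤ/N` (written multiplicatively), as a complex function. -/
noncomputable def ind (Φ : Finset (Multiplicative (ZMod N))) (x : ZMod N) : ℂ :=
  if Multiplicative.ofAdd x ∈ Φ then 1 else 0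

omit [NeZero N] in
/-- `ind Φ x = 1` iff `x ∈ Φ`. -/
theorem ind_apply_eq_one_iff (Φ : Finset (Multiplicative (ZMod N))) (x : ZMod N) :
    ind Φ x = 1 ↔ Multiplicative.ofAdd x ∈ Φ := by
  unfold ind; split_ifs with h <;> simp [h]

omit [NeZero N] in
/-- Membership in a Galois twist, additively: `x ∈ Φ g ↔ x − g ∈ Φ`. -/
theorem mem_rmul_ofAdd (Φ : Finset (Multiplicative (ZMod N))) (g x : ZMod N) :
    Multiplicative.ofAdd x ∈ rmul Φ (Multiplicative.ofAdd g) ↔ Multiplicative.ofAdd (x - g) ∈ Φ := by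
  rw [mem_rmul, ← ofAdd_neg, ← ofAdd_add, sub_eq_add_neg]

/-- `N/2` is a complex conjugation of `ℤ/N` in the typer's sense (central involution `≠ 1`). -/
theorem isComplexConj_ofAdd_half {m : ℕ} (hN : N = 2 * m) :
    IsComplexConj (Multiplicative.ofAdd (m : ZMod N)) where
  ne_one := by
    intro h
    rw [← ofAdd_zero] at h
    exact natCast_half_ne_zero hN (Multiplicative.ofAdd.injective h)
  mul_self := by
    rw [← ofAdd_add, ← Nat.cast_add, ← two_mul, ← hN, ZMod.natCast_self, ofAdd_zero]
  comm := fun g => mul_comm _ g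

omit [NeZero N] in
/-- The CM condition in additive coordinates: `1_Φ(x + N/2) = 1 − 1_Φ(x)`. -/
theorem ind_add_half {m : ℕ} (Φ : Finset (Multiplicative (ZMod N)))
    (hΦ : IsCMType (Multiplicative.ofAdd (m : ZMod N)) Φ) (x : ZMod N) :
    ind Φ (x + m) = 1 - ind Φ x := by
  have h := hΦ (Multiplicative.ofAdd x)
  rw [← ofAdd_add] at h
  unfold ind
  rw [add_comm x (m : ZMod N)]
  by_cases hx : Multiplicative.ofAdd x ∈ Φ
  · rw [if_pos hx, if_neg (h.mp hx)]; norm_num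
  · rw [if_neg hx, if_pos (by by_contra hc; exact hx (h.mpr hc))]; norm_num

omit [NeZero N] in
/-- `SumTwo` for the twists `Φ gᵢ`, additively: `∑ᵢ 1_Φ(x − gᵢ) = 2` for every `x`. -/
theorem sum_ind_twists (Φ : Finset (Multiplicative (ZMod N))) (g : Fin 4 → ZMod N)
    (hs : SumTwo (fun i => rmul Φ (Multiplicative.ofAdd (g i)))) (x : ZMod N) :
    ∑ i : Fin 4, ind Φ (x - g i) = 2 := by
  have h := hs (Multiplicative.ofAdd x)
  have e : ∀ i : Fin 4, ind Φ (x - g i) =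
      if Multiplicative.ofAdd x ∈ rmul Φ (Multiplicative.ofAdd (g i)) then (1 : ℂ) else 0 := by
    intro i; unfold ind; simp only [mem_rmul_ofAdd]
  simp only [e]
  rw [Finset.sum_boole, h]; norm_num

/-- The Fourier form of `SumTwo`: `(∑ᵢ ψ(−gᵢ k)) · 𝓕(1_Φ)(k) = 0` for every `k ≠ 0`. -/
theorem char_sum_mul_dft (Φ : Finset (Multiplicative (ZMod N))) (g : Fin 4 → ZMod N)
    (hs : SumTwo (fun i => rmul Φ (Multiplicative.ofAdd (g i)))) (k : ZMod N) (hk : k ≠ 0) :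
    (∑ i : Fin 4, stdAddChar (-(g i * k))) * ZMod.dft (ind Φ) k = 0 := by
  have h1 : (fun x => ∑ i : Fin 4, ind Φ (x - g i)) = fun _ => (2 : ℂ) :=
    funext (sum_ind_twists Φ g hs)
  have h2 : ZMod.dft (fun x => ∑ i : Fin 4, ind Φ (x - g i)) k =
      ∑ i : Fin 4, stdAddChar (-(g i * k)) * ZMod.dft (ind Φ) k := by
    have e : (fun x => ∑ i : Fin 4, ind Φ (x - g i)) = ∑ i : Fin 4, (fun x => ind Φ (x - g i)) := by
      funext x; simp only [Finset.sum_apply]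
    rw [e, map_sum, Finset.sum_apply]
    exact Finset.sum_congr rfl (fun i _ => dft_shift (ind Φ) (g i) k)
  rw [Finset.sum_mul, ← h2, h1, dft_const 2 k hk]

/-- The CM condition kills the Fourier coefficients at «even» `k` (those with `ψ(N/2 · k) = 1`). -/
theorem dft_ind_eq_zero_of_even {m : ℕ} (Φ : Finset (Multiplicative (ZMod N)))
    (hΦ : IsCMType (Multiplicative.ofAdd (m : ZMod N)) Φ) (k : ZMod N) (hk : k ≠ 0)
    (hmk : stdAddChar ((m : ZMod N) * k) = 1) : ZMod.dft (ind Φ) k = 0 := by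
  have h1 : (fun x => ind Φ (x - (-(m : ZMod N)))) = fun x => 1 - ind Φ x := by
    funext x; rw [sub_neg_eq_add, ind_add_half Φ hΦ]
  have h2 := dft_shift (ind Φ) (-(m : ZMod N)) k
  rw [h1, neg_mul, neg_neg, hmk, one_mul] at h2
  have h3 : ZMod.dft (fun x => 1 - ind Φ x) k = - ZMod.dft (ind Φ) k := by
    have e : (fun x : ZMod N => 1 - ind Φ x) = (fun _ => (1 : ℂ)) - ind Φ := by
      funext x; simp
    rw [e, map_sub, Pi.sub_apply, dft_const 1 k hk, zero_sub]
  rw [h3] at h2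
  have h4 : (2 : ℂ) * ZMod.dft (ind Φ) k = 0 := by linear_combination -h2
  exact (mul_eq_zero.mp h4).resolve_left two_ne_zero

/-- From a vanishing character sum over the four twists, an antipodal pair `ψ((g₀ − gⱼ) k) = -1`. -/
theorem exists_char_eq_neg_one (g : Fin 4 → ZMod N) (k : ZMod N)
    (h : ∑ i : Fin 4, stdAddChar (-(g i * k)) = 0) :
    ∃ j : Fin 4, stdAddChar ((g 0 - g j) * k) = -1 := by
  rw [Fin.sum_univ_four] at h
  have e : ∀ j : Fin 4, -(g j * k) - -(g 0 * k) = (g 0 - g j) * k := fun j => by ring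
  rcases four_roots h with h1 | h1 | h1
  · exact ⟨1, by rw [← e 1]; exact h1⟩
  · exact ⟨2, by rw [← e 2]; exact h1⟩
  · exact ⟨3, by rw [← e 3]; exact h1⟩

/-- A shift identity `1_Φ(x + (gᵢ − gⱼ)) = 1_Φ(x + N/2)` says exactly that `Φ gⱼ = c • Φ gᵢ`. -/
theorem conj_pair_of_shift {m : ℕ} (hN : N = 2 * m) (Φ : Finset (Multiplicative (ZMod N)))
    (g : Fin 4 → ZMod N) (i j : Fin 4)
    (h : ∀ x, ind Φ (x + (g i - g j)) = ind Φ (x + (m : ZMod N))) :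
    rmul Φ (Multiplicative.ofAdd (g j)) =
      Multiplicative.ofAdd (m : ZMod N) • rmul Φ (Multiplicative.ofAdd (g i)) := by
  ext y
  obtain ⟨x, rfl⟩ := Multiplicative.ofAdd.surjective y
  rw [mem_rmul_ofAdd, (isComplexConj_ofAdd_half hN).mem_smul_iff, ← ofAdd_add, mem_rmul_ofAdd,
    ← ind_apply_eq_one_iff, ← ind_apply_eq_one_iff]
  have h' := h (x - g i)
  have e1 : x - g i + (g i - g j) = x - g j := by ring
  have e2 : x - g i + (m : ZMod N) = (m : ZMod N) + x - g i := by ring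
  rw [e1, e2] at h'
  rw [h']

end HodgeRepro.CyclicQuad
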